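import Literature.NumberTheory.Automorphic.LocalPiFourierStieltjesUniqueness
import Mathlib.Algebra.MvPolynomial.Funext
import HarnessLib

/-!
# A Fourier–Stieltjes transform vanishing OFF AN ALGEBRAIC HYPERSURFACE vanishes (non-archimedean place, `F^ι`)

Topic `NumberTheory/Automorphic`; namespace `Literature.NumberTheory.Automorphic`.  KERNEL ONLY: theorems, 0 definitions,
0 records, 0 named facts, 0 `sorry`.  Sequel of `LocalPiFourierStieltjesUniqueness.lean`.

`F` a non-archimedean local field, `ι` finite, `ψ` a continuous non-trivial additive character, `(X, ν)` an s-finite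
measure space, `Φ : X → ℂ` integrable, `Q : X → F^ι` measurable.  The Fourier–Stieltjes transform of `Q_*(Φ ν)` is
`Φ̂_Q(η) = ∫_X ψ(⟨Q x, η⟩) Φ(x) dν`.

* §1 boxes are Zariski dense: every box `(𝔭^N)^ι` has infinite sides (`primePowBall_infinite`), so a polynomial
  `p ∈ F[T_i : i ∈ ι]` vanishing on a coset `a + (𝔭^N)^ι` is `0` (`MvPolynomial.funext_set`), i.e. a non-zero `p` has a
  non-root in every coset of every box (`exists_eval_ne_zero_of_vadd_piPrimePowBall`); hence **a locally constant
  function on `F^ι` vanishing off the zero locus of a non-zero polynomial vanishes identically**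
  (`eq_zero_of_isLocallyConstant_of_eval_ne_zero`);
* §2 `Φ̂_Q` is LOCALLY CONSTANT as soon as `Q` is bounded on the support of `Φ`: if `Q x ∈ (𝔭^{-R})^ι` whenever `Φ x ≠ 0`
  and `ψ` has conductor exponent `m`, then `Φ̂_Q(η + t) = Φ̂_Q(η)` for `t ∈ (𝔭^{m+R})^ι`
  (`integral_addChar_comp_mul_add_eq`) — `ψ(⟨Q x, t⟩) = 1` on the support;
* §3 **`integral_comp_mul_eq_zero_of_forall_eval_ne_zero`** — if `Φ̂_Q(η) = 0` for all `η` OFF the zero locus of some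
  non-zero polynomial `p` (and `Q` is bounded on the support of `Φ`), then `Φ̂_Q ≡ 0`, hence (previous file)
  `∫_X g(Q x) Φ(x) dν = 0` for every Schwartz–Bruhat `g` and `∫_{Q⁻¹(a+(𝔭^N)^ι)} Φ dν = 0` for every coset of every box.

The mathematics is [WeilBNT1967, Ch. VII §2] (Fourier inversion on standard functions) plus the remark that a
non-zero polynomial over an infinite field does not vanish on a box with infinite sides (Mathlib
`MvPolynomial.funext_set`).  Written for the cell `hodgecm-mathlib` (fan B, rung B-IV, KEY `b4-howe-compact-irreducible`,
node E7 of the doubling proof of `MoeglinVignerasWaldspurger1987.mvw_IV4_rankOne_irreducibleOrZero`: the Siegel–Weil values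
`b ↦ ∫_V ψ(⟨b, x x*⟩) φ(x) dx`, `b ∈ Herm_N(E_v) ≅ F_v^{N²}`, are shown to vanish only for `b ± 1` invertible, i.e. off
the hypersurface `det(b - 1) det(b + 1) = 0`; §3 removes the restriction).  Nothing about theta lifts is asserted here.

## References
* [WeilBNT1967] A. Weil, *Basic Number Theory* (1967), Chap. VII §2, Prop. 2, Cor. 1 (standard functions, Fourier
  inversion); Chap. II §2 Def. 2 (lattices / boxes).
-/

set_option autoImplicit false

noncomputable section

open _root_.MeasureTheory _root_.MeasureTheory.Measure Set Function
open scoped Pointwise NNReal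

namespace Literature.NumberTheory.Automorphic

open Literature.NumberTheory.GaloisRepresentations.IsNonarchimedeanLocalField
open Literature.NumberTheory.GaloisRepresentations

variable {F : Type*} [Field F] [ValuativeRel F] [TopologicalSpace F] [IsNonarchimedeanLocalField F]
  {ι : Type*} [Fintype ι]

/-! ## §1 Boxes have infinite sides; polynomials do not vanish on boxes; locally constant functions -/

omit [Fintype ι] in
variable (F) in
/-- every ball `𝔭^N` of a non-archimedean local field is INFINITE (it contains elements of norm `q^{-(N+k)}` for all
`k ∈ ℕ`, pairwise distinct). [cite: WeilBNT1967, Ch. II §2, Def. 2] -/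
theorem primePowBall_infinite (N : ℤ) : (primePowBall F N).Infinite := by
  -- `a k` of norm `q^{-(N+k)}`
  choose a ha0 ha using fun k : ℕ => exists_normAbs_eq_inv_zpow_of_int (F := F) (N + k)
  have hq1 : (residueFieldCard F : ℝ≥0)⁻¹ < 1 :=
    inv_lt_one_of_one_lt₀ (by exact_mod_cast one_lt_residueFieldCard F)
  have hq0 : 0 < (residueFieldCard F : ℝ≥0)⁻¹ :=
    inv_pos.2 (by exact_mod_cast Nat.zero_lt_one.trans (one_lt_residueFieldCard F))
  refine Set.infinite_of_injective_forall_mem (f := a) (fun k l hkl => ?_) fun k => ?_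
  · have h := ha k
    rw [hkl, ha l, zpow_right_inj₀ hq0 hq1.ne] at h
    exact_mod_cast (add_left_cancel h).symm
  · rw [mem_primePowBall_iff, ha k]
    exact zpow_le_zpow_right_of_le_one₀ hq0 hq1.le (by omega)

omit [Fintype ι] in
/-- **a non-zero polynomial has a non-root in every coset of every box** `a + (𝔭^N)^ι` (the box has infinite sides,
Mathlib `MvPolynomial.funext_set`). [cite: WeilBNT1967, Ch. II §2, Def. 2] -/
theorem exists_eval_ne_zero_of_vadd_piPrimePowBall {p : MvPolynomial ι F} (hp : p ≠ 0) (a : ι → F) (N : ℤ) :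
    ∃ x ∈ a +ᵥ piPrimePowBall F ι N, MvPolynomial.eval x p ≠ 0 := by
  by_contra h
  push Not at h
  apply hp
  -- `p` vanishes on the box `Π_i (a_i + 𝔭^N)` with infinite sides
  refine MvPolynomial.funext_set (fun i : ι => a i +ᵥ primePowBall F N)
    (fun i => ((primePowBall_infinite F N).image (add_right_injective (a i)).injOn).mono ?_) fun x hx => ?_
  · rintro _ ⟨t, ht, rfl⟩
    exact Set.mem_vadd_set.2 ⟨t, ht, rfl⟩
  · rw [map_zero]
    refine h x (mem_vadd_piPrimePowBall_iff.2 (mem_piPrimePowBall_iff.2 fun i => ?_))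
    have hi := hx i (Set.mem_univ i)
    obtain ⟨t, ht, hti⟩ := Set.mem_vadd_set.1 hi
    rw [Pi.sub_apply, ← hti, vadd_eq_add, add_sub_cancel_left]
    exact ht

/-- **a locally constant function on `F^ι` vanishing off the zero locus of a non-zero polynomial vanishes
identically** (the zero locus has empty interior: §1). [cite: WeilBNT1967, Ch. II §2, Def. 2] -/
theorem eq_zero_of_isLocallyConstant_of_eval_ne_zero {Y : Type*} [Zero Y] {g : (ι → F) → Y} (hg : IsLocallyConstant g)
    {p : MvPolynomial ι F} (hp : p ≠ 0) (h : ∀ x, MvPolynomial.eval x p ≠ 0 → g x = 0) : g = 0 := by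
  funext x₀
  -- `g` is constant on a box coset around `x₀`
  have h1 : {x | g x = g x₀} ∈ nhds x₀ := (hg.isOpen_fiber (g x₀)).mem_nhds rfl
  have h2 : (fun t => x₀ + t) ⁻¹' {x | g x = g x₀} ∈ nhds (0 : ι → F) :=
    (continuous_const.add continuous_id).continuousAt.preimage_mem_nhds (by simpa using h1)
  obtain ⟨N, hN⟩ := exists_piPrimePowBall_subset_of_mem_nhds_zero h2
  obtain ⟨x, hx, hpx⟩ := exists_eval_ne_zero_of_vadd_piPrimePowBall hp x₀ N
  obtain ⟨t, ht, rfl⟩ := Set.mem_vadd_set.1 hx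
  have hgx : g (x₀ + t) = g x₀ := hN ht
  rw [Pi.zero_apply, ← hgx]
  exact h _ hpx

/-! ## §2 Local constancy of the Fourier–Stieltjes transform of compactly supported data -/

section Fourier

variable [MeasurableSpace (ι → F)] [BorelSpace (ι → F)] {ψ : AddChar F Circle} {m : ℤ}
  {X : Type*} [MeasurableSpace X] (ν : Measure X)

omit [MeasurableSpace (ι → F)] [BorelSpace (ι → F)] in
/-- **`Φ̂_Q` is locally constant**: if `Q x ∈ (𝔭^{-R})^ι` whenever `Φ x ≠ 0` and `ψ` has conductor exponent `m`, then
`∫ ψ(⟨Q x, η + t⟩) Φ x dν = ∫ ψ(⟨Q x, η⟩) Φ x dν` for `t ∈ (𝔭^{m+R})^ι` (`⟨Q x, t⟩ ∈ 𝔭^m`, where `ψ = 1`).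
[cite: WeilBNT1967, Ch. VII §2, Prop. 2] -/
theorem integral_addChar_comp_mul_add_eq (hm : ψ.HasConductorExp m) {Φ : X → ℂ} {Q : X → ι → F} {R : ℤ}
    (hQ : ∀ x, Φ x ≠ 0 → Q x ∈ piPrimePowBall F ι (-R)) (η : ι → F) {t : ι → F}
    (ht : t ∈ piPrimePowBall F ι (m + R)) :
    ∫ x, ((ψ (Q x ⬝ᵥ (η + t)) : Circle) : ℂ) * Φ x ∂ν = ∫ x, ((ψ (Q x ⬝ᵥ η) : Circle) : ℂ) * Φ x ∂ν := by
  refine integral_congr_ae (Filter.Eventually.of_forall fun x => ?_)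
  simp only
  by_cases hx : Φ x = 0
  · rw [hx, mul_zero, mul_zero]
  · have hmem : Q x ⬝ᵥ t ∈ primePowBall F m := by
      have := dotProduct_mem_primePowBall (hQ x hx) ht
      rwa [show -R + (m + R) = m by ring] at this
    rw [dotProduct_add, AddChar.map_add_eq_mul, hm.1 _ hmem, mul_one]

omit [MeasurableSpace (ι → F)] [BorelSpace (ι → F)] in
/-- hence `η ↦ Φ̂_Q(η)` is locally constant on `F^ι`. [cite: WeilBNT1967, Ch. VII §2, Prop. 2] -/
theorem isLocallyConstant_integral_addChar_comp_mul (hψ : ψ.IsContinuousNontrivial) {Φ : X → ℂ} {Q : X → ι → F}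
    {R : ℤ} (hQ : ∀ x, Φ x ≠ 0 → Q x ∈ piPrimePowBall F ι (-R)) :
    IsLocallyConstant fun η : ι → F => ∫ x, ((ψ (Q x ⬝ᵥ η) : Circle) : ℂ) * Φ x ∂ν := by
  obtain ⟨m, hm⟩ := hψ.exists_hasConductorExp
  -- the fibres are unions of cosets of the open box `(𝔭^{m+R})^ι`
  refine (IsLocallyConstant.iff_exists_open _).2 fun η => ?_
  refine ⟨η +ᵥ piPrimePowBall F ι (m + R), isOpen_vadd_piPrimePowBall _ η, self_mem_vadd_piPrimePowBall _ η,
    fun η' hη' => ?_⟩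
  obtain ⟨t, ht, rfl⟩ := Set.mem_vadd_set.1 hη'
  exact integral_addChar_comp_mul_add_eq ν hm hQ η ht

/-! ## §3 Vanishing off a hypersurface ⇒ vanishing -/

variable [SFinite ν]

omit [SFinite ν] [MeasurableSpace (ι → F)] [BorelSpace (ι → F)] in
/-- **vanishing off the zero locus of a non-zero polynomial ⇒ vanishing everywhere** for `Φ̂_Q` (`Q` bounded on the
support of `Φ`). [cite: WeilBNT1967, Ch. VII §2, Prop. 2] -/
theorem integral_addChar_comp_mul_eq_zero_of_forall_eval_ne_zero (hψ : ψ.IsContinuousNontrivial) {Φ : X → ℂ}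
    {Q : X → ι → F} {R : ℤ} (hQ : ∀ x, Φ x ≠ 0 → Q x ∈ piPrimePowBall F ι (-R)) {p : MvPolynomial ι F} (hp : p ≠ 0)
    (h : ∀ η : ι → F, MvPolynomial.eval η p ≠ 0 → ∫ x, ((ψ (Q x ⬝ᵥ η) : Circle) : ℂ) * Φ x ∂ν = 0) (η : ι → F) :
    ∫ x, ((ψ (Q x ⬝ᵥ η) : Circle) : ℂ) * Φ x ∂ν = 0 :=
  congr_fun (eq_zero_of_isLocallyConstant_of_eval_ne_zero (isLocallyConstant_integral_addChar_comp_mul ν hψ hQ) hp h) η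

/-- **… hence `∫ g(Q x) Φ(x) dν = 0` for every Schwartz–Bruhat `g`** (previous file's uniqueness theorem).
[cite: WeilBNT1967, Ch. VII §2, Cor. 1] -/
theorem integral_comp_mul_eq_zero_of_forall_eval_ne_zero (hψ : ψ.IsContinuousNontrivial) {Φ : X → ℂ}
    (hΦ : Integrable Φ ν) {Q : X → ι → F} (hQm : Measurable Q) {R : ℤ}
    (hQ : ∀ x, Φ x ≠ 0 → Q x ∈ piPrimePowBall F ι (-R)) {p : MvPolynomial ι F} (hp : p ≠ 0)
    (h : ∀ η : ι → F, MvPolynomial.eval η p ≠ 0 → ∫ x, ((ψ (Q x ⬝ᵥ η) : Circle) : ℂ) * Φ x ∂ν = 0)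
    {g : (ι → F) → ℂ} (hg : g ∈ SchwartzBruhat (ι → F)) :
    ∫ x, g (Q x) * Φ x ∂ν = 0 :=
  integral_comp_mul_eq_zero_of_forall_integral_addChar_eq_zero ν hψ hΦ hQm
    (integral_addChar_comp_mul_eq_zero_of_forall_eval_ne_zero ν hψ hQ hp h) hg

/-- **… and `∫_{Q⁻¹(a + (𝔭^N)^ι)} Φ dν = 0` for every coset of every box.** [cite: WeilBNT1967, Ch. VII §2, Cor. 1] -/
theorem setIntegral_preimage_vadd_piPrimePowBall_eq_zero_of_forall_eval_ne_zero (hψ : ψ.IsContinuousNontrivial)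
    {Φ : X → ℂ} (hΦ : Integrable Φ ν) {Q : X → ι → F} (hQm : Measurable Q) {R : ℤ}
    (hQ : ∀ x, Φ x ≠ 0 → Q x ∈ piPrimePowBall F ι (-R)) {p : MvPolynomial ι F} (hp : p ≠ 0)
    (h : ∀ η : ι → F, MvPolynomial.eval η p ≠ 0 → ∫ x, ((ψ (Q x ⬝ᵥ η) : Circle) : ℂ) * Φ x ∂ν = 0)
    (a : ι → F) (N : ℤ) :
    ∫ x in Q ⁻¹' (a +ᵥ piPrimePowBall F ι N), Φ x ∂ν = 0 :=
  setIntegral_preimage_vadd_piPrimePowBall_eq_zero ν hψ hΦ hQm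
    (integral_addChar_comp_mul_eq_zero_of_forall_eval_ne_zero ν hψ hQ hp h) a N

end Fourier

end Literature.NumberTheory.Automorphic

end
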